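import Summits.KontsevichZagierPeriods.KontsevichZagierPeriods.Theorems.GaussManinCertificatesFibreRunsChains

/-!
# `KZStokes` (stmt-KontsevichZagierPeriods-3012), file 2/4: semialgebraic fibre runs (piece X₁)

Route `GaussManinCertificates`, crux `KZStokes`.  Second of the four files re-homing the crux
strategist's complete proof `Cruxes/KZStokes/Lines/KZStokesProof.lean` under `Theorems/` (lead c10 of
crux stmt-KontsevichZagierPeriods-9129; proof text verbatim):

* `cellRuns` — over ONE base set `S` of the adapted cylindrical decomposition, the maximal chains
  band–section–band (`exists_maximal_chains`, file 1) give finitely many open run bands over `S` with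
  `ℚ`-semialgebraic edges, fibres inside `σ_x` with end points on `frontier σ_x`, pairwise disjoint,
  exhausting `σ` over `S` up to the (null) graphs;
* `semialgebraicFibreRuns` — the registered stub `stub_semialgebraicFibreRuns` of line `runs_and_bands`
  (piece X₁ of the typed decomposition of `KZStokes`), verbatim: the PROVED adapted cylindrical
  decomposition `IsSemialgebraic.exists_cylindricalDecomposition_holds` feeds `cellRuns` cell by cell
  and `assembleRuns` (file 1) flattens.

No named fact is assumed; no new definition; axioms `propext`, `Classical.choice`, `Quot.sound` only.
References: Kontsevich–Zagier 2001, §1.2 (rules 1) and 3)); Basu–Pollack–Roy 2006, Thm. 5.6 /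
Cor. 5.7.
-/

noncomputable section

open MeasureTheory Set Filter Topology
open Literature.ModelTheory.ExponentialFields
open Literature.NumberTheory.Transcendental

namespace Summit.KontsevichZagierPeriods.GaussManinCertificates

/-! ### Runs over one base set -/

/-- **Runs over one cell** (registered stub `stub_cellRuns` of the birth skeleton of piece
`SemialgebraicFibreRuns`, verbatim): over ONE base set `S` on which the vertical fibres of the bounded
set `σ` are uniformly `⋃_{j ∈ G} {ξ_j x} ∪ ⋃_{j ∈ B} (ξ_{j-1} x, ξ_j x)` for strictly increasing
`ℚ`-semialgebraic sections `ξ` and fixed index sets `G`, `B` (bands of `B` lying in `σ`), the maximal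
chains band–section–band give finitely many open run bands over `S` with `ℚ`-semialgebraic edges, fibres
inside `σ_x` with end points on `frontier σ_x`, pairwise disjoint, exhausting `σ` over `S` up to the
(null) graphs. [Basu–Pollack–Roy 2006, Cor. 5.7; folklore] -/
theorem cellRuns :
    ∀ (n : ℕ) (σ : Set (Fin (n + 1) → ℝ)) (S : Set (Fin n → ℝ)) (l : ℕ) (ξ : Fin l → (Fin n → ℝ) → ℝ)
      (G : Finset (Fin l)) (B : Finset (Fin (l + 1))),
      Literature.ModelTheory.ExponentialFields.IsSemialgebraic ℚ σ → Bornology.IsBounded σ →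
      Literature.ModelTheory.ExponentialFields.IsSemialgebraic ℚ S →
      (∀ i, Literature.NumberTheory.Transcendental.IsSemialgebraicFunOn ℚ S (ξ i)) →
      (∀ x ∈ S, StrictMono fun i => ξ i x) →
      (∀ j ∈ B, Literature.ModelTheory.ExponentialFields.bandOver S ξ j ⊆ σ) →
      (∀ x ∈ S, {t : ℝ | (Fin.snoc x t : Fin (n + 1) → ℝ) ∈ σ} =
        (⋃ j ∈ G, {ξ j x}) ∪ ⋃ j ∈ B, {t : ℝ | Literature.ModelTheory.ExponentialFields.bandLower ξ j x < t ∧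
          (t : EReal) < Literature.ModelTheory.ExponentialFields.bandUpper ξ j x}) →
      ∃ (J : ℕ) (a b : Fin J → (Fin n → ℝ) → ℝ) (R : Fin J → Set (Fin (n + 1) → ℝ)),
        (∀ j, Literature.NumberTheory.Transcendental.IsSemialgebraicFunOn ℚ S (a j)) ∧
        (∀ j, Literature.NumberTheory.Transcendental.IsSemialgebraicFunOn ℚ S (b j)) ∧
        (∀ j, ∀ x ∈ S, a j x < b j x) ∧
        (∀ j, R j = {z : Fin (n + 1) → ℝ | Fin.init z ∈ S ∧
          z (Fin.last n) ∈ Set.Ioo (a j (Fin.init z)) (b j (Fin.init z))}) ∧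
        (∀ j, Literature.ModelTheory.ExponentialFields.IsSemialgebraic ℚ (R j)) ∧
        (∀ j, ∀ x ∈ S, Set.Ioo (a j x) (b j x) ⊆ {s : ℝ | (Fin.snoc x s : Fin (n + 1) → ℝ) ∈ σ}) ∧
        (∀ j, ∀ x ∈ S, a j x ∈ frontier {s : ℝ | (Fin.snoc x s : Fin (n + 1) → ℝ) ∈ σ} ∧
          b j x ∈ frontier {s : ℝ | (Fin.snoc x s : Fin (n + 1) → ℝ) ∈ σ}) ∧
        (Pairwise fun i j => Disjoint (R i) (R j)) ∧
        MeasureTheory.volume ((σ ∩ {z : Fin (n + 1) → ℝ | Fin.init z ∈ S}) \ ⋃ j, R j) = 0 := by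
  classical
  intro n σ S l ξ G B hσ hbdd hS hξ hmono hBσ hfib
  -- empty base: nothing to do
  rcases S.eq_empty_or_nonempty with hSe | ⟨x₀, hx₀⟩
  · subst hSe
    refine ⟨0, fun j => Fin.elim0 j, fun j => Fin.elim0 j, fun j => Fin.elim0 j, fun j => Fin.elim0 j,
      fun j => Fin.elim0 j, fun j => Fin.elim0 j, fun j => Fin.elim0 j, fun j => Fin.elim0 j,
      fun j => Fin.elim0 j, fun j => Fin.elim0 j, fun j => Fin.elim0 j, ?_⟩
    simp
  -- the sup norm controls the last coordinate
  obtain ⟨C, hC⟩ := isBounded_iff_forall_norm_le.1 hbdd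
  have hnorm : ∀ (x : Fin n → ℝ) (t : ℝ), (Fin.snoc x t : Fin (n + 1) → ℝ) ∈ σ → |t| ≤ C := by
    intro x t h
    have h1 := hC _ h
    have h2 := norm_le_pi_norm (Fin.snoc x t : Fin (n + 1) → ℝ) (Fin.last n)
    rw [Fin.snoc_last, Real.norm_eq_abs] at h2
    exact h2.trans h1
  -- the two unbounded bands are not in `B`
  have h0B : (0 : Fin (l + 1)) ∉ B := by
    intro h0
    obtain ⟨T, hT⟩ : ∃ T : ℝ, ∀ t : ℝ, t < T → ((t : ℝ) : EReal) < bandUpper ξ 0 x₀ := by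
      cases l with
      | zero =>
        refine ⟨0, fun t _ => ?_⟩
        rw [show (0 : Fin (0 + 1)) = Fin.last 0 from rfl, bandUpper_last]
        exact EReal.coe_lt_top _
      | succ l =>
        refine ⟨ξ 0 x₀, fun t ht => ?_⟩
        rw [bandUpper_zero]
        exact EReal.coe_lt_coe_iff.2 ht
    set t : ℝ := min (T - 1) (-(C + 1)) with ht_def
    have hmem : (Fin.snoc x₀ t : Fin (n + 1) → ℝ) ∈ σ := by
      refine hBσ 0 h0 (snoc_mem_bandOver_iff.2 ⟨hx₀, ?_, hT t ?_⟩)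
      · rw [bandLower_zero]
        exact EReal.bot_lt_coe _
      · have := min_le_left (T - 1) (-(C + 1))
        linarith
    have h1 := hnorm x₀ t hmem
    have h2 : t ≤ -(C + 1) := min_le_right _ _
    have h3 : -t ≤ |t| := neg_le_abs t
    linarith
  have hlB : Fin.last l ∉ B := by
    intro hl
    obtain ⟨T, hT⟩ : ∃ T : ℝ, ∀ t : ℝ, T < t → bandLower ξ (Fin.last l) x₀ < ((t : ℝ) : EReal) := by
      cases l with
      | zero =>
        refine ⟨0, fun t _ => ?_⟩
        rw [show Fin.last 0 = (0 : Fin (0 + 1)) from rfl, bandLower_zero]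
        exact EReal.bot_lt_coe _
      | succ l =>
        refine ⟨ξ (Fin.last l) x₀, fun t ht => ?_⟩
        rw [bandLower_last]
        exact EReal.coe_lt_coe_iff.2 ht
    set t : ℝ := max (T + 1) (C + 1) with ht_def
    have hmem : (Fin.snoc x₀ t : Fin (n + 1) → ℝ) ∈ σ := by
      refine hBσ _ hl (snoc_mem_bandOver_iff.2 ⟨hx₀, hT t ?_, ?_⟩)
      · have := le_max_left (T + 1) (C + 1)
        linarith
      · rw [bandUpper_last]
        exact EReal.coe_lt_top _
    have h1 := hnorm x₀ t hmem
    have h2 : C + 1 ≤ t := le_max_right _ _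
    have h3 : t ≤ |t| := le_abs_self t
    linarith
  -- the maximal chains of bands of `B` linked through sections of `G`
  let P : ℕ → Prop := fun k => ∃ j ∈ B, (j : ℕ) = k
  let Q : ℕ → Prop := fun m => ∃ i ∈ G, (i : ℕ) = m
  have hPb : ∀ k, P k → 0 < k ∧ k < l := by
    rintro k ⟨j, hj, rfl⟩
    refine ⟨Nat.pos_of_ne_zero fun h => h0B ?_, lt_of_le_of_ne (Nat.lt_succ_iff.1 j.isLt) fun h => hlB ?_⟩
    · have : j = 0 := Fin.ext h
      rwa [← this]
    · have : j = Fin.last l := Fin.ext (by rw [h, Fin.val_last])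
      rwa [← this]
  obtain ⟨J, p, q, hpq, hqL, hPch, hQch, hstart, hend, hcov, hdisj⟩ :=
    exists_maximal_chains l P Q hPb
  have hpL : ∀ j, p j < l := fun j => (hpq j).trans (hqL j)
  let ip : Fin J → Fin l := fun j => ⟨p j, hpL j⟩
  let iq : Fin J → Fin l := fun j => ⟨q j, hqL j⟩
  -- monotonicity of the sections
  have hlt_iff : ∀ x ∈ S, ∀ i i' : Fin l, ξ i x < ξ i' x ↔ i < i' := fun x hx i i' =>
    (hmono x hx).lt_iff_lt
  have hle_iff : ∀ x ∈ S, ∀ i i' : Fin l, ξ i x ≤ ξ i' x ↔ i ≤ i' := fun x hx i i' =>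
    (hmono x hx).le_iff_le
  -- the fibre of `σ` over `x ∈ S`, in terms of sections of `G` and bands of `B`
  have hF : ∀ x ∈ S, ∀ t : ℝ, (Fin.snoc x t : Fin (n + 1) → ℝ) ∈ σ ↔
      (∃ i ∈ G, t = ξ i x) ∨
        ∃ i i' : Fin l, (i' : ℕ) = i + 1 ∧ i.succ ∈ B ∧ ξ i x < t ∧ t < ξ i' x := by
    intro x hx t
    have ht : (Fin.snoc x t : Fin (n + 1) → ℝ) ∈ σ ↔
        t ∈ {t : ℝ | (Fin.snoc x t : Fin (n + 1) → ℝ) ∈ σ} := Iff.rfl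
    rw [ht, hfib x hx]
    simp only [mem_union, mem_iUnion, mem_singleton_iff, mem_setOf_eq, exists_prop]
    constructor
    · rintro (⟨i, hi, rfl⟩ | ⟨j, hj, hlo, hup⟩)
      · exact Or.inl ⟨i, hi, rfl⟩
      · right
        have hj0 : j ≠ 0 := fun h => h0B (h ▸ hj)
        have hjl : j ≠ Fin.last l := fun h => hlB (h ▸ hj)
        rw [bandLower_of_ne_zero ξ j hj0, EReal.coe_lt_coe_iff] at hlo
        rw [bandUpper_of_ne_last ξ j hjl, EReal.coe_lt_coe_iff] at hup
        refine ⟨j.pred hj0, j.castPred hjl, ?_, ?_, hlo, hup⟩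
        · rw [Fin.val_pred, Fin.coe_castPred]
          have : (j : ℕ) ≠ 0 := fun h => hj0 (Fin.ext h)
          omega
        · rw [Fin.succ_pred]
          exact hj
    · rintro (⟨i, hi, rfl⟩ | ⟨i, i', hii', hB, hlo, hup⟩)
      · exact Or.inl ⟨i, hi, rfl⟩
      · refine Or.inr ⟨i.succ, hB, ?_, ?_⟩
        · rw [bandLower_succ]
          exact EReal.coe_lt_coe_iff.2 hlo
        · have : i.succ = i'.castSucc := Fin.ext (by rw [Fin.val_succ, Fin.val_castSucc, hii'])
          rw [this, bandUpper_castSucc]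
          exact EReal.coe_lt_coe_iff.2 hup
  -- a section value never lies strictly inside a band
  have hsec_band : ∀ x ∈ S, ∀ m i i' : Fin l, (i' : ℕ) = i + 1 →
      ¬ (ξ i x < ξ m x ∧ ξ m x < ξ i' x) := by
    rintro x hx m i i' hii' ⟨h1, h2⟩
    rw [hlt_iff x hx] at h1 h2
    have h1' := Fin.lt_def.1 h1
    have h2' := Fin.lt_def.1 h2
    omega
  -- the fibres of the runs lie in the fibres of `σ`
  have hIoo : ∀ j, ∀ x ∈ S, Ioo (ξ (ip j) x) (ξ (iq j) x) ⊆
      {s : ℝ | (Fin.snoc x s : Fin (n + 1) → ℝ) ∈ σ} := by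
    intro j x hx t ht
    rw [mem_setOf_eq, hF x hx]
    -- the highest section below or at `t`
    let I : Finset (Fin l) := (Finset.univ : Finset (Fin l)).filter fun i : Fin l => ξ i x ≤ t
    have hIp : ip j ∈ I := Finset.mem_filter.2 ⟨Finset.mem_univ _, ht.1.le⟩
    have hIne : I.Nonempty := ⟨_, hIp⟩
    have hi₀I : I.max' hIne ∈ I := Finset.max'_mem _ _
    have hi₀t : ξ (I.max' hIne) x ≤ t := (Finset.mem_filter.1 hi₀I).2
    have hmax : ∀ i : Fin l, ξ i x ≤ t → i ≤ I.max' hIne := fun i hi =>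
      Finset.le_max' I i (Finset.mem_filter.2 ⟨Finset.mem_univ i, hi⟩)
    set i₀ := I.max' hIne with hi₀_def
    have hpi₀ : ip j ≤ i₀ := hmax _ ht.1.le
    have hi₀q : i₀ < iq j := by
      rw [← hlt_iff x hx]
      exact lt_of_le_of_lt hi₀t ht.2
    have hpi₀' := Fin.le_def.1 hpi₀
    have hi₀q' := Fin.lt_def.1 hi₀q
    rcases hi₀t.eq_or_lt with heq | hlt
    · -- `t` is the section `i₀`, strictly between `p` and `q`, hence in `G`
      left
      have hne : ip j ≠ i₀ := by
        intro h
        rw [← h] at heq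
        exact (ne_of_lt ht.1) heq
      have hpi₀'' : (p j : ℕ) < i₀ := lt_of_le_of_ne hpi₀' fun h => hne (Fin.ext h)
      obtain ⟨i, hi, hii₀⟩ := hQch j i₀ hpi₀'' hi₀q'
      have hi' : i = i₀ := Fin.ext hii₀
      exact ⟨i₀, hi' ▸ hi, heq.symm⟩
    · -- `t` lies in the band above the section `i₀`
      right
      have hi₀l : (i₀ : ℕ) + 1 < l := by
        have := (iq j).isLt
        simp only [iq] at this hi₀q'
        omega
      refine ⟨i₀, ⟨i₀ + 1, hi₀l⟩, rfl, ?_, hlt, ?_⟩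
      · obtain ⟨j', hj', hj'v⟩ := hPch j (i₀ + 1) (by simp only [ip] at hpi₀'; omega)
          (by simp only [iq] at hi₀q'; omega)
        have : j' = i₀.succ := Fin.ext (by rw [hj'v, Fin.val_succ])
        exact this ▸ hj'
      · by_contra h
        have h' := hmax ⟨i₀ + 1, hi₀l⟩ (not_lt.mp h)
        have := Fin.le_def.1 h'
        simp at this
  -- sections outside `G` and bands outside `B` miss the fibre of `σ`
  have hnotmem : ∀ x ∈ S, ∀ m : Fin l, m ∉ G →
      ξ m x ∉ {s : ℝ | (Fin.snoc x s : Fin (n + 1) → ℝ) ∈ σ} := by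
    intro x hx m hm hmem
    rw [mem_setOf_eq, hF x hx] at hmem
    rcases hmem with ⟨i, hi, heq⟩ | ⟨i, i', hii', -, h1, h2⟩
    · have : m = i := (hmono x hx).injective heq
      exact hm (this ▸ hi)
    · exact hsec_band x hx m i i' hii' ⟨h1, h2⟩
  have hband_out : ∀ x ∈ S, ∀ i i' : Fin l, (i' : ℕ) = i + 1 → i.succ ∉ B →
      Ioo (ξ i x) (ξ i' x) ⊆ {s : ℝ | (Fin.snoc x s : Fin (n + 1) → ℝ) ∈ σ}ᶜ := by
    intro x hx i i' hii' hiB t ht hmem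
    rw [mem_setOf_eq, hF x hx] at hmem
    rcases hmem with ⟨m, -, rfl⟩ | ⟨k, k', hkk', hkB, h1, h2⟩
    · exact hsec_band x hx m i i' hii' ht
    · have h3 := Fin.lt_def.1 ((hlt_iff x hx _ _).1 (ht.1.trans h2))
      have h4 := Fin.lt_def.1 ((hlt_iff x hx _ _).1 (h1.trans ht.2))
      have : k = i := Fin.ext (by omega)
      subst this
      exact hiB hkB
  have hbelow : ∀ x ∈ S, ∀ t : ℝ, (∀ i : Fin l, t < ξ i x) →
      t ∉ {s : ℝ | (Fin.snoc x s : Fin (n + 1) → ℝ) ∈ σ} := by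
    intro x hx t ht hmem
    rw [mem_setOf_eq, hF x hx] at hmem
    rcases hmem with ⟨m, -, rfl⟩ | ⟨k, -, -, -, h1, -⟩
    · exact lt_irrefl _ (ht m)
    · exact lt_asymm h1 (ht k)
  have habove : ∀ x ∈ S, ∀ t : ℝ, (∀ i : Fin l, ξ i x < t) →
      t ∉ {s : ℝ | (Fin.snoc x s : Fin (n + 1) → ℝ) ∈ σ} := by
    intro x hx t ht hmem
    rw [mem_setOf_eq, hF x hx] at hmem
    rcases hmem with ⟨m, -, rfl⟩ | ⟨-, k', -, -, -, h2⟩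
    · exact lt_irrefl _ (ht m)
    · exact lt_asymm h2 (ht k')
  -- the end points of the runs are frontier points of the fibres
  have hab : ∀ j, ∀ x ∈ S, ξ (ip j) x < ξ (iq j) x := fun j x hx =>
    (hlt_iff x hx _ _).2 (Fin.mk_lt_mk.2 (hpq j))
  have hfront : ∀ j, ∀ x ∈ S,
      ξ (ip j) x ∈ frontier {s : ℝ | (Fin.snoc x s : Fin (n + 1) → ℝ) ∈ σ} ∧
        ξ (iq j) x ∈ frontier {s : ℝ | (Fin.snoc x s : Fin (n + 1) → ℝ) ∈ σ} := by
    intro j x hx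
    constructor
    · refine mem_frontier_left_of_Ioo_subset (hab j x hx) (hIoo j x hx) ?_
      by_cases hQ : ip j ∈ G
      · right
        have hnotP : ¬ P (p j) := fun hP' => hstart j ⟨hP', ⟨ip j, hQ, rfl⟩⟩
        by_cases hp0 : p j = 0
        · refine ⟨ξ (ip j) x - 1, by linarith, fun t ht => hbelow x hx t fun i => ?_⟩
          calc t < ξ (ip j) x := ht.2
            _ ≤ ξ i x := (hle_iff x hx _ _).2 (Fin.le_def.2 (by simp only [ip]; omega))
        · have hp1 : p j - 1 < l := by have := hpL j; omega
          refine ⟨ξ ⟨p j - 1, hp1⟩ x, (hlt_iff x hx _ _).2 (Fin.mk_lt_mk.2 (by omega)),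
            hband_out x hx ⟨p j - 1, hp1⟩ (ip j) (by simp only [ip]; omega) fun hB' =>
              hnotP ⟨_, hB', ?_⟩⟩
          show p j - 1 + 1 = p j
          omega
      · exact Or.inl (hnotmem x hx _ hQ)
    · refine mem_frontier_right_of_Ioo_subset (hab j x hx) (hIoo j x hx) ?_
      by_cases hQ : iq j ∈ G
      · right
        have hnotP : ¬ P (q j + 1) := fun hP' => hend j ⟨⟨iq j, hQ, rfl⟩, hP'⟩
        by_cases hql : q j + 1 < l
        · refine ⟨ξ ⟨q j + 1, hql⟩ x, (hlt_iff x hx _ _).2 (Fin.mk_lt_mk.2 (by omega)),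
            hband_out x hx (iq j) ⟨q j + 1, hql⟩ rfl fun hB' => hnotP ⟨_, hB', ?_⟩⟩
          rw [Fin.val_succ]
        · refine ⟨ξ (iq j) x + 1, by linarith, fun t ht => habove x hx t fun i => ?_⟩
          calc ξ i x ≤ ξ (iq j) x :=
                (hle_iff x hx _ _).2 (Fin.le_def.2 (by have := i.isLt; simp only [iq]; omega))
            _ < t := ht.1
      · exact Or.inl (hnotmem x hx _ hQ)
  -- the runs
  refine ⟨J, fun j => ξ (ip j), fun j => ξ (iq j), fun j => {z : Fin (n + 1) → ℝ | Fin.init z ∈ S ∧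
      z (Fin.last n) ∈ Ioo (ξ (ip j) (Fin.init z)) (ξ (iq j) (Fin.init z))}, fun j => hξ _,
    fun j => hξ _, hab, fun j => rfl, fun j => isSemialgebraic_openBand (hξ _) (hξ _), hIoo, hfront,
    ?_, ?_⟩
  · -- distinct runs are disjoint
    intro i j hij
    rw [Set.disjoint_left]
    rintro z ⟨hzS, h1, h2⟩ ⟨-, h3, h4⟩
    rcases hdisj i j hij with h | h
    · have := (hle_iff _ hzS (iq i) (ip j)).2 (Fin.mk_le_mk.2 h)
      linarith
    · have := (hle_iff _ hzS (iq j) (ip i)).2 (Fin.mk_le_mk.2 h)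
      linarith
  · -- the remainder over `S` lies in the graphs of the sections
    have hrem : (σ ∩ {z : Fin (n + 1) → ℝ | Fin.init z ∈ S}) \
        (⋃ j, {z : Fin (n + 1) → ℝ | Fin.init z ∈ S ∧
          z (Fin.last n) ∈ Ioo (ξ (ip j) (Fin.init z)) (ξ (iq j) (Fin.init z))}) ⊆
        ⋃ i : Fin l, {z : Fin (n + 1) → ℝ | Fin.init z ∈ S ∧ z (Fin.last n) = ξ i (Fin.init z)} := by
      rintro z ⟨⟨hzσ, hzS⟩, hz⟩
      rw [mem_setOf_eq] at hzS
      have hzσ' : (Fin.snoc (Fin.init z) (z (Fin.last n)) : Fin (n + 1) → ℝ) ∈ σ := by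
        rwa [Fin.snoc_init_self]
      rw [hF _ hzS] at hzσ'
      rcases hzσ' with ⟨i, -, hi⟩ | ⟨i, i', hii', hiB, h1, h2⟩
      · exact mem_iUnion.2 ⟨i, hzS, hi⟩
      · exfalso
        obtain ⟨j, hpj, hjq⟩ := hcov (i + 1) ⟨i.succ, hiB, by rw [Fin.val_succ]⟩
        refine hz (mem_iUnion.2 ⟨j, hzS, ?_, ?_⟩)
        · calc ξ (ip j) (Fin.init z) ≤ ξ i (Fin.init z) :=
                (hle_iff _ hzS _ _).2 (Fin.le_def.2 (by simp only [ip]; omega))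
            _ < z (Fin.last n) := h1
        · calc z (Fin.last n) < ξ i' (Fin.init z) := h2
            _ ≤ ξ (iq j) (Fin.init z) :=
                (hle_iff _ hzS _ _).2 (Fin.le_def.2 (by simp only [iq]; omega))
    exact measure_mono_null hrem
      (measure_iUnion_null_iff.2 fun i => KZ.volume_graph_eq_zero (hξ i))

/-! ### The fibre-run decomposition -/

/-- **`SemialgebraicFibreRuns`** (piece X₁ of the typed decomposition of `KZStokes`; the statement is,
verbatim, the registered stub `stub_semialgebraicFibreRuns` of line `runs_and_bands` of crux
stmt-KontsevichZagierPeriods-3012): every bounded `ℚ`-semialgebraic `σ ⊆ ℝⁿ⁺¹` is, off a null set, a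
finite disjoint union of open run bands over `ℚ`-semialgebraic bases with `ℚ`-semialgebraic edges, with
fibres inside `σ_x` and end points on `frontier σ_x` — the adapted cylindrical decomposition (PROVED in
the tree) feeds `cellRuns` cell by cell and `assembleRuns` flattens. [Basu–Pollack–Roy 2006, Cor. 5.7] -/
theorem semialgebraicFibreRuns :
    ∀ (n : ℕ) (σ : Set (Fin (n + 1) → ℝ)), Literature.ModelTheory.ExponentialFields.IsSemialgebraic ℚ σ → Bornology.IsBounded σ → ∃ (J : ℕ) (S : Fin J → Set (Fin n → ℝ)) (a b : Fin J → (Fin n → ℝ) → ℝ) (R : Fin J → Set (Fin (n + 1) → ℝ)), (∀ j, Literature.ModelTheory.ExponentialFields.IsSemialgebraic ℚ (S j)) ∧ (∀ j, Literature.NumberTheory.Transcendental.IsSemialgebraicFunOn ℚ (S j) (a j)) ∧ (∀ j, Literature.NumberTheory.Transcendental.IsSemialgebraicFunOn ℚ (S j) (b j)) ∧ (∀ j, ∀ x ∈ S j, a j x < b j x) ∧ (∀ j, R j = {z : Fin (n + 1) → ℝ | Fin.init z ∈ S j ∧ z (Fin.last n) ∈ Set.Ioo (a j (Fin.init z)) (b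 j (Fin.init z))}) ∧ (∀ j, Literature.ModelTheory.ExponentialFields.IsSemialgebraic ℚ (R j)) ∧ (∀ j, ∀ x ∈ S j, Set.Ioo (a j x) (b j x) ⊆ {s : ℝ | (Fin.snoc x s : Fin (n + 1) → ℝ) ∈ σ}) ∧ (∀ j, ∀ x ∈ S j, a j x ∈ frontier {s : ℝ | (Fin.snoc x s : Fin (n + 1) → ℝ) ∈ σ} ∧ b j x ∈ frontier {s : ℝ | (Fin.snoc x s : Fin (n + 1) → ℝ) ∈ σ}) ∧ (Pairwise fun i j => Disjoint (R i) (R j)) ∧ MeasureTheory.volume (σ \ ⋃ j, R j) = 0 := by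
  intro n σ hσ hbdd
  obtain ⟨𝒮, l, ξ, h𝒮, -, hsa, hmono, -, hGB⟩ :=
    IsSemialgebraic.exists_cylindricalDecomposition.exists_fibre_eq
      (IsSemialgebraic.exists_cylindricalDecomposition_holds (k := ℚ)) hσ
  refine assembleRuns n σ 𝒮 h𝒮.isPartition h𝒮.isSemialgebraic fun S hS => ?_
  obtain ⟨G, B, -, hB, hfib⟩ := hGB S hS
  exact cellRuns n σ S (l S) (ξ S) G B hσ hbdd (h𝒮.isSemialgebraic S hS) (hsa S hS) (hmono S hS) hB hfib

end Summit.KontsevichZagierPeriods.GaussManinCertificates
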